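import Literature.MathematicalPhysics.QuantumLattice.ShastryPairingInequalities
import Literature.MathematicalPhysics.QuantumLattice.FinDimSpectrumProofs
import Literature.MathematicalPhysics.QuantumLattice.FermionOperatorsProofs
import Literature.MathematicalPhysics.QuantumLattice.PairCorrelationsProofs
import Literature.MathematicalPhysics.QuantumLattice.HubbardGaugeBound
import HarnessLib

/-!
# Shastry's projected-pair inequalities (3) and (5): discharge

Trunk T-QLATTICE, family `hubbard`. Sibling proof file of
`Literature/MathematicalPhysics/QuantumLattice/ShastryPairingInequalities.lean`: it DISCHARGES the
named fact (`def … : Prop`, D-0014)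

* `shastry_pair_projection_inequalities_holds : shastry_pair_projection_inequalities` —
  B. S. Shastry, J. Phys. A 30 (1997) L635 (arXiv:cond-mat/9612098), Ineqs. (3)–(5) at projection
  coupling `U_s = 0`: for a ground state `ψ₀` of `H̃ = H(t, U) - μ N` on the torus `(ℤ/Lℤ)^d`,
  `(U - 2μ) ⟨Bψ₀, Bψ₀⟩ ≤ re ⟨Bψ₀, Aψ₀⟩` and, if `U - 2μ ≥ 0`,
  `(U - 2μ)² ⟨Bψ₀, Bψ₀⟩ ≤ ⟨Aψ₀, Aψ₀⟩`, where `B = Σ_x c_{x↓} c_{x↑}` and `A = [T, B]`.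

No statement or definition is introduced or changed here. The other named fact of that file,
`sawadaWarke_inequality` (Shastry's Ineq. (2), `0 ≤ re ⟨ψ₀, Mᴴ [H̃, M] ψ₀⟩`), is a separate
discharge unit; this file proves and uses its matrix-element form
`re_star_mulVec_dotProduct_commutator_mulVec_nonneg` (`0 ≤ re ⟨Mψ₀, [H̃, M] ψ₀⟩`, the same
number since `⟨ψ₀, Mᴴ v⟩ = ⟨Mψ₀, v⟩`).

## Proof (Shastry's three lines, Ineqs. (2)–(5) of Shastry1997, pp. 2–3 of the arXiv text)

1. *Sawada–Warke.* `⟨Mψ₀, [H̃, M] ψ₀⟩ = ⟨Mψ₀, H̃ Mψ₀⟩ - Ẽ₀ ⟨Mψ₀, Mψ₀⟩ ≥ 0` because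
   `H̃ - Ẽ₀ ≥ 0` (`Matrix.posSemidef_sub_groundEnergy`, with
   `Matrix.minEnergyOn_top_holds : H̃.minEnergyOn ⊤ = Ẽ₀`) — "inserting a complete set of energy
   eigenfunctions".
2. *The commutator.* `B = (η†₁)ᴴ` with `η†₁ = Σ_x c†_{x↑} c†_{x↓}` Yang's `η†` for the constant
   sign `ε ≡ 1` (`uniformOnSitePair_eq_conjTranspose_etaRaise`). The tree's CAR computations
   `[Σ_x n_{x↑} n_{x↓}, η†] = η†` (`interaction_commutator_etaRaise`) and `[N, η†] = 2η†`
   (`totalNumber_commutator_etaRaise_holds`) give `[H̃, η†] = [T, η†] + (U - 2μ) η†`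
   (`hamiltonianWith_commutator_etaRaise`); taking adjoints (`H̃`, `T` Hermitian,
   `isHermitian_hamiltonianWith`) gives `[H̃, B] = [T, B] - (U - 2μ) B = A - (U - 2μ) B`
   (`hubbardTorusWith_commutator_uniformOnSitePair`; Shastry: `[B, B†] = 𝓛 - N̂`,
   coefficient `U_s(𝓛 - N + 2) - 2μ + U` at `U_s = 0`). With `M = B` in step 1:
   `0 ≤ re ⟨Bψ₀, Aψ₀⟩ - (U - 2μ) ⟨Bψ₀, Bψ₀⟩`, which is Ineq. (3).
3. *Cauchy–Schwarz* (Ineq. (4)): `re ⟨Bψ₀, Aψ₀⟩ ≤ ‖Bψ₀‖ ‖Aψ₀‖` (the tree's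
   `re_star_dotProduct_le_norm_mul_norm`, `norm_toLp_sq_eq_re`, via `EuclideanSpace ℂ n`); with
   `U - 2μ ≥ 0`, cancelling `‖Bψ₀‖` in `(U - 2μ) ‖Bψ₀‖² ≤ ‖Bψ₀‖ ‖Aψ₀‖` (or `‖Bψ₀‖ = 0`, when
   Ineq. (5) is trivial) and squaring gives Ineq. (5).

## Sources

B. S. Shastry, *Uncertainty principle enhanced pairing correlations in projected Fermi systems
near half filling*, J. Phys. A 30 (1997) L635–L641, arXiv:cond-mat/9612098 [Shastry1997],
Ineqs. (2)–(5) (pp. 2–3 of the arXiv text); K. Sawada, C. S. Warke, Phys. Rev. 133 (1964) A1252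
(Shastry's ref. (sw)); C. N. Yang, PRL 63 (1989) 2144 (the `η`-algebra) [Yang1989].
-/

noncomputable section

open scoped ComplexOrder

namespace Literature.MathematicalPhysics.QuantumLattice

open Matrix Finset

/-! ### Linear-algebra preliminaries: the pairing `⟨u, v⟩ = star u ⬝ᵥ v` on `m → ℂ` -/

section LinAlg

variable {m : Type*} [Fintype m]

/-- **Cauchy–Schwarz**, packaged over the reals: there are `‖u‖, ‖v‖ ≥ 0` with
`re ⟨u, u⟩ = ‖u‖²`, `re ⟨v, v⟩ = ‖v‖²` and `re ⟨u, v⟩ ≤ ‖u‖ ‖v‖` (the `ℓ²` norms of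
`EuclideanSpace ℂ m`; the tree's `norm_toLp_sq_eq_re` and `re_star_dotProduct_le_norm_mul_norm`).
This is the form of Shastry's Ineq. (4) used below. [cite: Shastry1997, Ineq. (4)] -/
theorem exists_norms_re_star_dotProduct_le (u v : m → ℂ) :
    ∃ nu nv : ℝ, 0 ≤ nu ∧ 0 ≤ nv ∧ (star u ⬝ᵥ u).re = nu ^ 2 ∧ (star v ⬝ᵥ v).re = nv ^ 2 ∧
      (star u ⬝ᵥ v).re ≤ nu * nv :=
  ⟨_, _, norm_nonneg _, norm_nonneg _, (norm_toLp_sq_eq_re u).symm, (norm_toLp_sq_eq_re v).symm,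
    re_star_dotProduct_le_norm_mul_norm u v⟩

variable [DecidableEq m]

/-- Variational principle, unnormalised form: `E₀ · ⟨φ, φ⟩ ≤ re ⟨φ, A φ⟩` for Hermitian `A`
(`A - E₀ ≥ 0`, `Matrix.posSemidef_sub_groundEnergy`). Tasaki (2020) §2.1, (2.1.6);
Reed–Simon IV, Thm. XIII.1. [folklore] -/
theorem groundEnergy_mul_le_re_rayleigh {A : Matrix m m ℂ} (hA : A.IsHermitian) (φ : m → ℂ) :
    A.groundEnergy * (star φ ⬝ᵥ φ).re ≤ (star φ ⬝ᵥ A *ᵥ φ).re := by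
  have h := (Matrix.posSemidef_sub_groundEnergy hA).dotProduct_mulVec_nonneg φ
  rw [sub_mulVec, dotProduct_sub, Algebra.algebraMap_eq_smul_one, smul_mulVec, one_mulVec,
    dotProduct_smul] at h
  obtain ⟨hre, -⟩ := Complex.nonneg_iff.mp h
  rw [Complex.sub_re, Complex.real_smul, Complex.re_ofReal_mul] at hre
  linarith

/-- **Sawada–Warke inequality, matrix-element form.** If `H` is Hermitian and `H ψ₀ = Ẽ₀ ψ₀`
with `Ẽ₀ = H.minEnergyOn ⊤` (`= H.groundEnergy`, `Matrix.minEnergyOn_top_holds`), then for every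
matrix `M`, `re ⟨Mψ₀, [H, M] ψ₀⟩ = re ⟨Mψ₀, H Mψ₀⟩ - Ẽ₀ ⟨Mψ₀, Mψ₀⟩ ≥ 0` by the variational
principle (`groundEnergy_mul_le_re_rayleigh`) — Shastry's Ineq. (2),
`⟨ψ₀| M† [H̃, M] |ψ₀⟩ ≥ 0`, "readily proved by inserting a complete set of energy eigenfunctions"
(the named fact `sawadaWarke_inequality` is this statement with `Mᴴ` in the left slot,
`⟨ψ₀, Mᴴ v⟩ = ⟨Mψ₀, v⟩`). On an empty index type both sides vanish. Shastry's ref. (sw) is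
K. Sawada, C. S. Warke, Phys. Rev. 133 (1964) A1252. [cite: Shastry1997, Ineq. (2)] -/
theorem re_star_mulVec_dotProduct_commutator_mulVec_nonneg {H : Matrix m m ℂ} (hH : H.IsHermitian)
    (M : Matrix m m ℂ) {ψ₀ : m → ℂ} (hψ : H *ᵥ ψ₀ = ((H.minEnergyOn ⊤ : ℝ) : ℂ) • ψ₀) :
    0 ≤ (star (M *ᵥ ψ₀) ⬝ᵥ ((H * M - M * H) *ᵥ ψ₀)).re := by
  rcases isEmpty_or_nonempty m with hm | hm
  · simp [dotProduct]
  rw [Matrix.minEnergyOn_top_holds hH] at hψ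
  rw [sub_mulVec, ← mulVec_mulVec, ← mulVec_mulVec, hψ, mulVec_smul, dotProduct_sub,
    dotProduct_smul, smul_eq_mul, Complex.sub_re, Complex.re_ofReal_mul, sub_nonneg]
  exact groundEnergy_mul_le_re_rayleigh hH (M *ᵥ ψ₀)

end LinAlg

/-! ### The commutator `[H̃, η†]` for an arbitrary sign, and its adjoint -/

section Graph

variable {Λ : Type*} [LinearOrder Λ] [Fintype Λ] (G : SimpleGraph Λ) [DecidableRel G.Adj]

/-- `[H(t, U) - μ N, η†_ε] = [H(t, 0), η†_ε] + (U - 2μ) η†_ε` on any finite graph and for any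
sign `ε`: the interaction contributes `U η†` (`interaction_commutator_etaRaise`,
`[Σ_x n_{x↑} n_{x↓}, η†] = η†`) and the chemical potential `-μ · 2η†`
(`totalNumber_commutator_etaRaise_holds`, `[N, η†] = 2η†`); the hopping part `H(t, 0)` is kept
as a commutator (it vanishes only for bipartite `ε`, `hopping_commute_etaRaise`).
Yang, PRL 63 (1989) 2144, eq. (6); Shastry (1997), text before Ineq. (3).
[cite: Shastry1997, derivation of Ineq. (3)] -/
theorem hamiltonianWith_commutator_etaRaise (ε : Λ → ℤˣ) (t U μ : ℝ) :
    hamiltonianWith G t U μ * etaRaise ε - etaRaise ε * hamiltonianWith G t U μ =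
      (hamiltonian G t 0 * etaRaise ε - etaRaise ε * hamiltonian G t 0) +
        ((U - 2 * μ : ℝ) : ℂ) • etaRaise ε := by
  have hV : (∑ x, numberOp x 0 * numberOp x 1) * etaRaise ε =
      etaRaise ε + etaRaise ε * ∑ x, numberOp x 0 * numberOp x 1 :=
    sub_eq_iff_eq_add.1 (interaction_commutator_etaRaise ε)
  have hN : (totalNumber : Matrix (Finset (Orb Λ)) (Finset (Orb Λ)) ℂ) * etaRaise ε =
      (2 : ℂ) • etaRaise ε + etaRaise ε * totalNumber :=
    sub_eq_iff_eq_add.1 (totalNumber_commutator_etaRaise_holds ε)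
  simp only [hamiltonianWith, hamiltonian, Complex.ofReal_zero, zero_smul, add_zero, sub_mul,
    mul_sub, add_mul, mul_add, smul_mul_assoc, mul_smul_comm, hV, hN, smul_add, Complex.ofReal_sub,
    Complex.ofReal_mul, Complex.ofReal_ofNat]
  module

/-- Adjoint form: for the pair ANNIHILATION field `η_ε = (η†_ε)ᴴ`,
`[H(t, U) - μ N, η_ε] = [H(t, 0), η_ε] - (U - 2μ) η_ε` (conjugate-transpose of
`hamiltonianWith_commutator_etaRaise`; `H(t, U) - μ N` and `H(t, 0)` are Hermitian,
`isHermitian_hamiltonianWith`). Shastry (1997), text before Ineq. (3) (`[H̃, B] = A - (U - 2μ) B`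
at `U_s = 0`). [cite: Shastry1997, derivation of Ineq. (3)] -/
theorem hamiltonianWith_commutator_conjTranspose_etaRaise (ε : Λ → ℤˣ) (t U μ : ℝ) :
    hamiltonianWith G t U μ * (etaRaise ε)ᴴ - (etaRaise ε)ᴴ * hamiltonianWith G t U μ =
      (hamiltonian G t 0 * (etaRaise ε)ᴴ - (etaRaise ε)ᴴ * hamiltonian G t 0) -
        ((U - 2 * μ : ℝ) : ℂ) • (etaRaise ε)ᴴ := by
  have hH := (isHermitian_hamiltonianWith G t U μ).eq
  have hT : (hamiltonian G t 0)ᴴ = hamiltonian G t 0 := by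
    simpa using (isHermitian_hamiltonianWith G t 0 0).eq
  have h := congrArg conjTranspose (hamiltonianWith_commutator_etaRaise G ε t U μ)
  rw [conjTranspose_sub, conjTranspose_mul, conjTranspose_mul, hH, conjTranspose_add,
    conjTranspose_sub, conjTranspose_mul, conjTranspose_mul, hT, conjTranspose_smul] at h
  have hc : star ((U - 2 * μ : ℝ) : ℂ) = ((U - 2 * μ : ℝ) : ℂ) := Complex.conj_ofReal _
  rw [hc] at h
  rw [← neg_sub, h]
  abel

end Graph

/-! ### Shastry's operators on the torus -/

section Torus

variable (d L : ℕ) [NeZero L]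

/-- `B = (η†₁)ᴴ`: Shastry's uniform on-site pair field `Σ_x c_{x↓} c_{x↑}` is the adjoint of
Yang's `η† = Σ_x ε_x c†_{x↑} c†_{x↓}` with the constant sign `ε ≡ 1` (reindexing the sites of
`(ℤ/Lℤ)^d` along `FermionTorus.equivTorusSite`). Shastry (1997), definition of `B` below eq. (1),
case (α). [cite: Shastry1997, eq. (1)] -/
theorem uniformOnSitePair_eq_conjTranspose_etaRaise :
    uniformOnSitePair d L = (etaRaise (fun _ : FermionTorus d L => (1 : ℤˣ)))ᴴ := by
  rw [uniformOnSitePair, etaRaise, conjTranspose_sum]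
  refine Fintype.sum_equiv (FermionTorus.equivTorusSite (d := d) (L := L)).symm _ _ fun x => ?_
  simp [onSitePair, FermionTorus.equivTorusSite, conjTranspose_mul]

/-- **Shastry's commutator** `[H̃, B] = A - (U - 2μ) B` for the pure Hubbard model on the torus
(`H̃ = H(t, U) - μ N`, `B = Σ_x c_{x↓} c_{x↑}`, `A = [T, B]`, `T = H(t, 0)` the hopping term):
the case `U_s = 0` of `[H̃, B] = A - {U_s(𝓛 - N + 2) - 2μ + U} B`.
[cite: Shastry1997, derivation of Ineq. (3)] -/
theorem hubbardTorusWith_commutator_uniformOnSitePair (t U μ : ℝ) :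
    hubbardTorusWith d L t U μ * uniformOnSitePair d L -
        uniformOnSitePair d L * hubbardTorusWith d L t U μ =
      hoppingPairCommutator d L t - ((U - 2 * μ : ℝ) : ℂ) • uniformOnSitePair d L := by
  rw [hoppingPairCommutator, uniformOnSitePair_eq_conjTranspose_etaRaise]
  exact hamiltonianWith_commutator_conjTranspose_etaRaise (fermionTorusGraph d L) _ t U μ

end Torus

/-! ### Shastry's inequalities (3) and (5) at `U_s = 0` -/

/-- **Discharge of `shastry_pair_projection_inequalities`** (Shastry, J. Phys. A 30 (1997) L635,
Ineqs. (3)–(5) at `U_s = 0`). (i) The Sawada–Warke inequality in matrix-element form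
(`re_star_mulVec_dotProduct_commutator_mulVec_nonneg`) with `M = B` and the commutator
`[H̃, B] = A - (U - 2μ) B` (`hubbardTorusWith_commutator_uniformOnSitePair`) give
`0 ≤ re ⟨Bψ₀, Aψ₀⟩ - (U - 2μ) ⟨Bψ₀, Bψ₀⟩`, Ineq. (3). (ii) For `U - 2μ ≥ 0`, (i) and
Cauchy–Schwarz (`exists_norms_re_star_dotProduct_le`, Ineq. (4)) give
`(U - 2μ) ‖Bψ₀‖² ≤ ‖Bψ₀‖ ‖Aψ₀‖`, whence Ineq. (5) after cancelling `‖Bψ₀‖` (trivial when it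
vanishes) and squaring. [cite: Shastry1997, Ineqs. (3)–(5) with U_s = 0] -/
theorem shastry_pair_projection_inequalities_holds : shastry_pair_projection_inequalities := by
  intro d L _ t U μ ψ₀ hψ
  set H := hubbardTorusWith d L t U μ
  set B := uniformOnSitePair d L
  set A := hoppingPairCommutator d L t
  have hH : H.IsHermitian := isHermitian_hamiltonianWith (fermionTorusGraph d L) t U μ
  have hcomm : H * B - B * H = A - ((U - 2 * μ : ℝ) : ℂ) • B :=
    hubbardTorusWith_commutator_uniformOnSitePair d L t U μ
  -- (i): Sawada–Warke (matrix-element form) with `M = B`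
  have hSW := re_star_mulVec_dotProduct_commutator_mulVec_nonneg hH B hψ
  rw [hcomm, sub_mulVec, smul_mulVec, dotProduct_sub, dotProduct_smul, smul_eq_mul, Complex.sub_re,
    Complex.re_ofReal_mul, sub_nonneg] at hSW
  refine ⟨hSW, fun ha => ?_⟩
  -- (ii): Cauchy–Schwarz, cancellation of `‖Bψ₀‖`, squaring
  obtain ⟨nB, nA, hnB0, -, hbB, hcA, hCS⟩ :=
    exists_norms_re_star_dotProduct_le (B *ᵥ ψ₀) (A *ᵥ ψ₀)
  rw [hbB] at hSW
  rw [hbB, hcA]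
  rcases hnB0.eq_or_lt with h0 | hpos
  · rw [← h0, zero_pow two_ne_zero, mul_zero]
    positivity
  · have h3 : (U - 2 * μ) * nB * nB ≤ nA * nB :=
      calc (U - 2 * μ) * nB * nB = (U - 2 * μ) * nB ^ 2 := by ring
        _ ≤ _ := hSW
        _ ≤ nB * nA := hCS
        _ = nA * nB := mul_comm _ _
    have h4 : (U - 2 * μ) * nB ≤ nA := le_of_mul_le_mul_right h3 hpos
    have h5 := pow_le_pow_left₀ (mul_nonneg ha hnB0) h4 2
    rwa [mul_pow] at h5

end Literature.MathematicalPhysics.QuantumLattice
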